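import Summits.QuantumFields.YangMills.Theorems.BalabanUVNodesN21GappedCollarDesignIJunctionPair
import Summits.QuantumFields.YangMills.Theorems.BalabanUVNodesN21GappedTopPair13CoPHSlotDefs

/-!
# N21 (NE7c) · THE CONSUMER's JUNCTION AT THE RESUMMED LEVEL FOR THE GAPPED TOP PAIR: design (i)'s two-run CORE of the last 𝐓-step weight with BOTH the (3.2) and the (3.3)
# families refined lies between dag-n21-w7's doubly-gapped step weight `wGap2At θlo θhi δlo δhi` and the pair-lettered step weight `wTop2At θ δ′`, POINTWISE

Track A of `YM-PLAN.md` (cell `pub-ymgap`), node **N21** (NE7c, NOT PRINTED); WIDTH SEAT `pub-ymgap-dag-n21-w2` (gen 3), file 8.  THEOREMS ONLY: 0 `def`, 0 `sorry`; COUNT-NEUTRAL;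
`--kind proof --supports stmt-QuantumFields-27366 --as helper` (K3⁸).  Imports this seat's file 7 `…GappedCollarDesignIJunctionPair` (→ files 1, 3: `aGapAt_le_core_of_bgClose`,
`core_le_aWeightAt`, `bGapAt_le_core_of_device`, `core_le_bWeightAt`, the devices) and dag-n21-w7's `…GappedTopPair13CoPHSlotDefs` (p626059 ✓: `wTop2At`, `wTop2At_apply_top`, `ωGap2At`,
`wGap2At`, `wGap2At_apply`).  No Theses import; restates nothing; the two-run pair core is written INLINE with def-T's `resumWeights` (no object minted).

WHY.  File 5 typed the resummed junction with the (3.2) family refined and the (3.3) family of record; dag-n21-w7 gaps BOTH families (`ωGap2At = aGapAt · bGapAt · ζ`, `wGap2At`,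
`wTop2At θ δ′`).  Design (i) refines both indicator families of the last 𝐓-step against run B; its two-run core weight is `Σ_t core^{(3.2)}_t · core^{(3.3)}_t · ζ(t)` — run B's (3.2)
factors at its top field `V′_B` through `ι`, run B's (3.3) factors at its pair `(U_B, V′_B)` through `ι` (both runs' pinned (3.3) data `sect3DataOfRecord`).  Under the two-way
closeness hypotheses of files 3 (backgrounds, (3.2) scale, `Δ`) and 7 (fluctuation variables, (3.3) scale, `Δ′`) and the two collars, that core weight lies ABOVE `wGap2At` and (always,
at the top step) BELOW `wTop2At θ δ′`; so design (i)'s resummed pair deficit is at most the doubly-gapped deficit `wTop2At θ δ′ − wGap2At θlo θhi δlo δhi` — the integrand of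
dag-n21-w7's two-family collar shell `topGap2ShellAt` before the old front factor, the dressed slot and the transport.  POINTWISE ONLY (no joint law; `U_B, V′_B` free parameters).

WHAT IS PROVED ([bookkeeping] BY NAME).
* ★★ `wGap2At_le_twoRunCore2_of_close` · `twoRunCore2_nonneg` · ★ `twoRunCore2_le_wTop2At` (top step `k + 1 = p.K`) · ★★ `wTop2At_sub_twoRunCore2_le_wTop2At_sub_wGap2At_of_close`.

HONEST FRAMING.  Pointwise bookkeeping; both closeness hypotheses, `ι`, collars DISPLAYED (NE3 species, NOT PRINTED); `U_B, V′_B` free; nothing of Bałaban's asserted; NE7c NOT PRINTED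
∕ NOT proved; **N21 NOT discharged**; K3⁷∕K3⁸ NOT claimed; counts UNMOVED (typed 28∕28 · discharged 5∕27); never a count claim.  One finite four-torus programme at fixed `ε` — NOT ℝ⁴,
NOT OS, NOT a mass gap, NOT the Clay problem.  No decl below carries a cite tag.
-/

open Finset

namespace Summit.QuantumFields.YangMills.Theorems.N21GappedCollarDesignIResummedPair

open Literature.MathematicalPhysics.QuantumFieldTheory.Balaban1983to89
open Literature.MathematicalPhysics.QuantumFieldTheory.Balaban1983to89.T4Continuum
open Literature.MathematicalPhysics.QuantumFieldTheory.Balaban1983to89.Node00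
open B14.Eq216Concrete (ukBox)
open B14.Sect3Decomp (SmallApproxFluct Vbox)
open GaugeField (plaqHol)
open GaugeGroup (dist1)
open Summit.QuantumFields.YangMills.Theorems.N21ShellSplitOfRecord13CoPH (aGapAt aGapAt_of_not_subset aGapAt_nonneg)
open Summit.QuantumFields.YangMills.Theorems.N21GappedTopPair13CoPH
  (bFactorAt bFactorAt_nonneg bFactorAt_le_one bFactorAt_mono bGapAt bGapAt_of_not_subset bGapAt_nonneg ωGap2At wGap2At wGap2At_apply wTop2At wTop2At_apply_top)
open Summit.QuantumFields.YangMills.Theorems.N21GappedCollarDesignI (core_le_aWeightAt)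
open Summit.QuantumFields.YangMills.Theorems.N21TwoRunDevice (aGapAt_le_core_of_bgClose)
open Summit.QuantumFields.YangMills.Theorems.N21GappedCollarDesignIPair (bGapAt_le_core_of_device core_le_bWeightAt bDevice_AB_of_fluctClose bDevice_BA_of_fluctClose)

variable (F : T4Family) (N : ℕ) [NeZero N] (ϑ : Stage9Params F N)

/-- ★★ **THE DOUBLY-GAPPED STEP WEIGHT LIES BELOW THE TWO-RUN PAIR CORE WEIGHT.**  Run A `(p, g, k)`, top history `s′`, fields `(U, V′)`; run B `(p′, g′, k′)` with old history `s_B`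
and fields `(U_B, V′_B)`; site identification `ι`; (3.2)-scale two-way domination of the local backgrounds up to `Δ ≥ 0` with collar `θlo + Δ ≤ θ ≤ θhi − Δ`; (3.3)-scale two-way bond-wise
domination of the fluctuation variables (run A's data pinned at `s′.init`) up to `Δ′ ≥ 0` with collar `δlo + Δ′ ≤ δ′ ≤ δhi − Δ′`; row `0 ≤ ζ`.  Then `wGap2At θlo θhi δlo δhi (s′)(U,V′)`
is at most the two-run pair core weight (written with `resumWeights`, guards `[P_t ⊆ cubes32]`, `[Q_t ⊆ qcubes P_t]`). [bookkeeping] -/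
theorem wGap2At_le_twoRunCore2_of_close (hζ0 : ∀ p g k s Pl Ql RS U V', 0 ≤ ϑ.ζ p g k s Pl Ql RS U V')
    {p p' : B12.RunParams} {g g' : ℕ → ℝ} {k k' : ℕ} (ι : Iχ F ϑ.ν p g k → Iχ F ϑ.ν p' g' k')
    (s' : SeqOfRecord F ϑ.ν ϑ.τ9.M g p.K (k + 1)) (sB : SeqOfRecord F ϑ.ν ϑ.τ9.M g' p'.K k')
    (U : GaugeField (F.P p.K) k (SU N)) (V' : GaugeField (F.P p.K) (k + 1) (SU N)) (UB : GaugeField (F.P p'.K) k' (SU N)) (VB : GaugeField (F.P p'.K) (k' + 1) (SU N))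
    {Δ Δ' : ℝ} (hΔ : 0 ≤ Δ) (hΔ' : 0 ≤ Δ')
    (hAB : ∀ c : Iχ F ϑ.ν p g k, ∀ q' ∈ plaqInside (cubeEnl (F.P p'.K) (sideχ F ϑ.ν p' g' k') (ι c) 1), ∃ q ∈ plaqInside (cubeEnl (F.P p.K) (sideχ F ϑ.ν p g k) c 1),
      dist1 (plaqHol (ukBox (bgOfRecord (avOfRecord F N p'.K) {U | PlaqSmall (ϑ.ν.εreg * (F.P p'.K).eta (k' + 1) ^ 2) U}) ϑ.ν.M₁
          (cubeEnl (F.P p'.K) (sideχ F ϑ.ν p' g' k') (ι c) 4) (k' + 1) VB) q') / (F.P p'.K).eta (k' + 1) ^ 2 ≤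
        dist1 (plaqHol (ukBox (bgOfRecord (avOfRecord F N p.K) {U | PlaqSmall (ϑ.ν.εreg * (F.P p.K).eta (k + 1) ^ 2) U}) ϑ.ν.M₁
          (cubeEnl (F.P p.K) (sideχ F ϑ.ν p g k) c 4) (k + 1) V') q) / (F.P p.K).eta (k + 1) ^ 2 + Δ)
    (hBA : ∀ c : Iχ F ϑ.ν p g k, ∀ q ∈ plaqInside (cubeEnl (F.P p.K) (sideχ F ϑ.ν p g k) c 1), ∃ q' ∈ plaqInside (cubeEnl (F.P p'.K) (sideχ F ϑ.ν p' g' k') (ι c) 1),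
      dist1 (plaqHol (ukBox (bgOfRecord (avOfRecord F N p.K) {U | PlaqSmall (ϑ.ν.εreg * (F.P p.K).eta (k + 1) ^ 2) U}) ϑ.ν.M₁
          (cubeEnl (F.P p.K) (sideχ F ϑ.ν p g k) c 4) (k + 1) V') q) / (F.P p.K).eta (k + 1) ^ 2 ≤
        dist1 (plaqHol (ukBox (bgOfRecord (avOfRecord F N p'.K) {U | PlaqSmall (ϑ.ν.εreg * (F.P p'.K).eta (k' + 1) ^ 2) U}) ϑ.ν.M₁
          (cubeEnl (F.P p'.K) (sideχ F ϑ.ν p' g' k') (ι c) 4) (k' + 1) VB) q') / (F.P p'.K).eta (k' + 1) ^ 2 + Δ)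
    (hAB' : ∀ c : Iχ F ϑ.ν p g k, ∀ b' ∈ (sect3DataOfRecord F N ϑ.ν ϑ.τ9.M p' g' k' sB).bondsStar (ι c), ∃ b ∈ (sect3DataOfRecord F N ϑ.ν ϑ.τ9.M p g k s'.init).bondsStar c,
      dist1 (UB b' * (Vbox (sect3DataOfRecord F N ϑ.ν ϑ.τ9.M p' g' k' sB) (avOfRecord F N p'.K) (ι c) VB b')⁻¹) ≤
        dist1 (U b * (Vbox (sect3DataOfRecord F N ϑ.ν ϑ.τ9.M p g k s'.init) (avOfRecord F N p.K) c V' b)⁻¹) + Δ')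
    (hBA' : ∀ c : Iχ F ϑ.ν p g k, ∀ b ∈ (sect3DataOfRecord F N ϑ.ν ϑ.τ9.M p g k s'.init).bondsStar c, ∃ b' ∈ (sect3DataOfRecord F N ϑ.ν ϑ.τ9.M p' g' k' sB).bondsStar (ι c),
      dist1 (U b * (Vbox (sect3DataOfRecord F N ϑ.ν ϑ.τ9.M p g k s'.init) (avOfRecord F N p.K) c V' b)⁻¹) ≤
        dist1 (UB b' * (Vbox (sect3DataOfRecord F N ϑ.ν ϑ.τ9.M p' g' k' sB) (avOfRecord F N p'.K) (ι c) VB b')⁻¹) + Δ')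
    {θlo θ θhi δlo δ' δhi : ℝ} (hlo : θlo + Δ ≤ θ) (hhi : θ + Δ ≤ θhi) (hlo' : δlo + Δ' ≤ δ') (hhi' : δ' + Δ' ≤ δhi) :
    wGap2At F N ϑ θlo θhi δlo δhi p g k s' U V' ≤
      resumWeights (σOfRecord F ϑ.ν ϑ.τ9.M p g k)
        (fun s t U V' =>
          (if t.1 ⊆ cubes32 F ϑ.ν ϑ.τ9.M p g k s then
              (∏ c ∈ cubes32 F ϑ.ν ϑ.τ9.M p g k s \ t.1, (chiFactorAt F N ϑ.ν p g k θ c V' * chiFactorAt F N ϑ.ν p' g' k' θ (ι c) VB)) *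
                ∏ c ∈ t.1, ((1 - chiFactorAt F N ϑ.ν p g k θ c V') * (1 - chiFactorAt F N ϑ.ν p' g' k' θ (ι c) VB))
            else 0) *
          (if t.2.1 ⊆ qcubes F ϑ.ν ϑ.τ9.M p g k s t.1 then
              (∏ c ∈ qcubes F ϑ.ν ϑ.τ9.M p g k s t.1 \ t.2.1, (bFactorAt F N ϑ.ν ϑ.τ9.M p g k δ' s c U V' * bFactorAt F N ϑ.ν ϑ.τ9.M p' g' k' δ' sB (ι c) UB VB)) *
                ∏ c ∈ t.2.1, ((1 - bFactorAt F N ϑ.ν ϑ.τ9.M p g k δ' s c U V') * (1 - bFactorAt F N ϑ.ν ϑ.τ9.M p' g' k' δ' sB (ι c) UB VB))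
            else 0) *
            ϑ.ζ p g k s t.1 t.2.1 t.2.2 U V')
        s' U V' := by
  classical
  rw [wGap2At_apply]
  unfold resumWeights
  refine Finset.sum_le_sum fun t _ => ?_
  dsimp only [ωGap2At]
  have hz := hζ0 p g k s'.init t.1 t.2.1 t.2.2 U V'
  have ha0 := aGapAt_nonneg F N ϑ.ν ϑ.τ9.M p g k θlo θhi s'.init t.1 V'
  have hb0 := bGapAt_nonneg F N ϑ.ν ϑ.τ9.M p g k δlo δhi s'.init t.1 t.2.1 U V'
  -- the (3.2) core and the (3.3) core, with their range guards
  have hcoreA0 : 0 ≤ (if t.1 ⊆ cubes32 F ϑ.ν ϑ.τ9.M p g k s'.init then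
        (∏ c ∈ cubes32 F ϑ.ν ϑ.τ9.M p g k s'.init \ t.1, (chiFactorAt F N ϑ.ν p g k θ c V' * chiFactorAt F N ϑ.ν p' g' k' θ (ι c) VB)) *
          ∏ c ∈ t.1, ((1 - chiFactorAt F N ϑ.ν p g k θ c V') * (1 - chiFactorAt F N ϑ.ν p' g' k' θ (ι c) VB))
        else 0) := by
    split_ifs
    · exact mul_nonneg (prod_nonneg fun c _ => mul_nonneg (chiFactorAt_nonneg F N ϑ.ν p g k θ c V') (chiFactorAt_nonneg F N ϑ.ν p' g' k' θ (ι c) VB))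
        (prod_nonneg fun c _ => mul_nonneg (sub_nonneg.2 (chiFactorAt_le_one F N ϑ.ν p g k θ c V')) (sub_nonneg.2 (chiFactorAt_le_one F N ϑ.ν p' g' k' θ (ι c) VB)))
    · exact le_rfl
  have hA : aGapAt F N ϑ.ν ϑ.τ9.M p g k θlo θhi s'.init t.1 V' ≤ (if t.1 ⊆ cubes32 F ϑ.ν ϑ.τ9.M p g k s'.init then
        (∏ c ∈ cubes32 F ϑ.ν ϑ.τ9.M p g k s'.init \ t.1, (chiFactorAt F N ϑ.ν p g k θ c V' * chiFactorAt F N ϑ.ν p' g' k' θ (ι c) VB)) *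
          ∏ c ∈ t.1, ((1 - chiFactorAt F N ϑ.ν p g k θ c V') * (1 - chiFactorAt F N ϑ.ν p' g' k' θ (ι c) VB))
        else 0) := by
    by_cases hP : t.1 ⊆ cubes32 F ϑ.ν ϑ.τ9.M p g k s'.init
    · rw [if_pos hP]; exact aGapAt_le_core_of_bgClose F N ϑ.ν ϑ.τ9.M ι V' VB hΔ hAB hBA hlo hhi s'.init hP
    · rw [if_neg hP, aGapAt_of_not_subset F N ϑ.ν ϑ.τ9.M p g k θlo θhi s'.init hP V']
  have hB : bGapAt F N ϑ.ν ϑ.τ9.M p g k δlo δhi s'.init t.1 t.2.1 U V' ≤ (if t.2.1 ⊆ qcubes F ϑ.ν ϑ.τ9.M p g k s'.init t.1 then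
        (∏ c ∈ qcubes F ϑ.ν ϑ.τ9.M p g k s'.init t.1 \ t.2.1, (bFactorAt F N ϑ.ν ϑ.τ9.M p g k δ' s'.init c U V' * bFactorAt F N ϑ.ν ϑ.τ9.M p' g' k' δ' sB (ι c) UB VB)) *
          ∏ c ∈ t.2.1, ((1 - bFactorAt F N ϑ.ν ϑ.τ9.M p g k δ' s'.init c U V') * (1 - bFactorAt F N ϑ.ν ϑ.τ9.M p' g' k' δ' sB (ι c) UB VB))
        else 0) := by
    by_cases hQ : t.2.1 ⊆ qcubes F ϑ.ν ϑ.τ9.M p g k s'.init t.1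
    · rw [if_pos hQ]
      exact bGapAt_le_core_of_device F N ϑ.ν ϑ.τ9.M p g k s'.init hQ U V' (fun c θ' => bFactorAt F N ϑ.ν ϑ.τ9.M p' g' k' θ' sB (ι c) UB VB)
        (fun c θ' => bFactorAt_nonneg F N ϑ.ν ϑ.τ9.M p' g' k' θ' sB (ι c) UB VB) (fun c θ' => bFactorAt_le_one F N ϑ.ν ϑ.τ9.M p' g' k' θ' sB (ι c) UB VB)
        (fun c _ _ h => bFactorAt_mono F N ϑ.ν ϑ.τ9.M p' g' k' h sB (ι c) UB VB) (bDevice_AB_of_fluctClose F N ϑ.ν ϑ.τ9.M ι s'.init sB U V' UB VB hAB')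
        (bDevice_BA_of_fluctClose F N ϑ.ν ϑ.τ9.M ι s'.init sB U V' UB VB hBA') hΔ' hlo' hhi'
    · rw [if_neg hQ, bGapAt_of_not_subset F N ϑ.ν ϑ.τ9.M p g k δlo δhi s'.init hQ U V']
  exact mul_le_mul_of_nonneg_right (mul_le_mul hA hB hb0 hcoreA0) hz

/-- **THE TWO-RUN PAIR CORE WEIGHT IS NONNEGATIVE** (row `0 ≤ ζ`). [bookkeeping] -/
theorem twoRunCore2_nonneg (hζ0 : ∀ p g k s Pl Ql RS U V', 0 ≤ ϑ.ζ p g k s Pl Ql RS U V')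
    {p p' : B12.RunParams} {g g' : ℕ → ℝ} {k k' : ℕ} (ι : Iχ F ϑ.ν p g k → Iχ F ϑ.ν p' g' k') (θ δ' : ℝ)
    (s' : SeqOfRecord F ϑ.ν ϑ.τ9.M g p.K (k + 1)) (sB : SeqOfRecord F ϑ.ν ϑ.τ9.M g' p'.K k')
    (U : GaugeField (F.P p.K) k (SU N)) (V' : GaugeField (F.P p.K) (k + 1) (SU N)) (UB : GaugeField (F.P p'.K) k' (SU N)) (VB : GaugeField (F.P p'.K) (k' + 1) (SU N)) :
    0 ≤ resumWeights (σOfRecord F ϑ.ν ϑ.τ9.M p g k)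
        (fun s t U V' =>
          (if t.1 ⊆ cubes32 F ϑ.ν ϑ.τ9.M p g k s then
              (∏ c ∈ cubes32 F ϑ.ν ϑ.τ9.M p g k s \ t.1, (chiFactorAt F N ϑ.ν p g k θ c V' * chiFactorAt F N ϑ.ν p' g' k' θ (ι c) VB)) *
                ∏ c ∈ t.1, ((1 - chiFactorAt F N ϑ.ν p g k θ c V') * (1 - chiFactorAt F N ϑ.ν p' g' k' θ (ι c) VB))
            else 0) *
          (if t.2.1 ⊆ qcubes F ϑ.ν ϑ.τ9.M p g k s t.1 then
              (∏ c ∈ qcubes F ϑ.ν ϑ.τ9.M p g k s t.1 \ t.2.1, (bFactorAt F N ϑ.ν ϑ.τ9.M p g k δ' s c U V' * bFactorAt F N ϑ.ν ϑ.τ9.M p' g' k' δ' sB (ι c) UB VB)) *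
                ∏ c ∈ t.2.1, ((1 - bFactorAt F N ϑ.ν ϑ.τ9.M p g k δ' s c U V') * (1 - bFactorAt F N ϑ.ν ϑ.τ9.M p' g' k' δ' sB (ι c) UB VB))
            else 0) *
            ϑ.ζ p g k s t.1 t.2.1 t.2.2 U V')
        s' U V' := by
  classical
  unfold resumWeights
  refine Finset.sum_nonneg fun t _ => ?_
  dsimp only
  refine mul_nonneg (mul_nonneg ?_ ?_) (hζ0 p g k s'.init t.1 t.2.1 t.2.2 U V')
  · split_ifs
    · exact mul_nonneg (prod_nonneg fun c _ => mul_nonneg (chiFactorAt_nonneg F N ϑ.ν p g k θ c V') (chiFactorAt_nonneg F N ϑ.ν p' g' k' θ (ι c) VB))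
        (prod_nonneg fun c _ => mul_nonneg (sub_nonneg.2 (chiFactorAt_le_one F N ϑ.ν p g k θ c V')) (sub_nonneg.2 (chiFactorAt_le_one F N ϑ.ν p' g' k' θ (ι c) VB)))
    · exact le_rfl
  · split_ifs
    · exact mul_nonneg (prod_nonneg fun c _ => mul_nonneg (bFactorAt_nonneg F N ϑ.ν ϑ.τ9.M p g k δ' _ c U V') (bFactorAt_nonneg F N ϑ.ν ϑ.τ9.M p' g' k' δ' sB (ι c) UB VB))
        (prod_nonneg fun c _ => mul_nonneg (sub_nonneg.2 (bFactorAt_le_one F N ϑ.ν ϑ.τ9.M p g k δ' _ c U V')) (sub_nonneg.2 (bFactorAt_le_one F N ϑ.ν ϑ.τ9.M p' g' k' δ' sB (ι c) UB VB)))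
    · exact le_rfl

/-- ★ **THE TWO-RUN PAIR CORE WEIGHT LIES BELOW THE PAIR-LETTERED STEP WEIGHT `wTop2At θ δ′`** at the top step `k + 1 = p.K` (row `0 ≤ ζ`; no closeness needed). [bookkeeping] -/
theorem twoRunCore2_le_wTop2At (hζ0 : ∀ p g k s Pl Ql RS U V', 0 ≤ ϑ.ζ p g k s Pl Ql RS U V')
    {p p' : B12.RunParams} {g g' : ℕ → ℝ} {k k' : ℕ} (hk : k + 1 = p.K) (ι : Iχ F ϑ.ν p g k → Iχ F ϑ.ν p' g' k') (θ δ' : ℝ)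
    (s' : SeqOfRecord F ϑ.ν ϑ.τ9.M g p.K (k + 1)) (sB : SeqOfRecord F ϑ.ν ϑ.τ9.M g' p'.K k')
    (U : GaugeField (F.P p.K) k (SU N)) (V' : GaugeField (F.P p.K) (k + 1) (SU N)) (UB : GaugeField (F.P p'.K) k' (SU N)) (VB : GaugeField (F.P p'.K) (k' + 1) (SU N)) :
    resumWeights (σOfRecord F ϑ.ν ϑ.τ9.M p g k)
        (fun s t U V' =>
          (if t.1 ⊆ cubes32 F ϑ.ν ϑ.τ9.M p g k s then
              (∏ c ∈ cubes32 F ϑ.ν ϑ.τ9.M p g k s \ t.1, (chiFactorAt F N ϑ.ν p g k θ c V' * chiFactorAt F N ϑ.ν p' g' k' θ (ι c) VB)) *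
                ∏ c ∈ t.1, ((1 - chiFactorAt F N ϑ.ν p g k θ c V') * (1 - chiFactorAt F N ϑ.ν p' g' k' θ (ι c) VB))
            else 0) *
          (if t.2.1 ⊆ qcubes F ϑ.ν ϑ.τ9.M p g k s t.1 then
              (∏ c ∈ qcubes F ϑ.ν ϑ.τ9.M p g k s t.1 \ t.2.1, (bFactorAt F N ϑ.ν ϑ.τ9.M p g k δ' s c U V' * bFactorAt F N ϑ.ν ϑ.τ9.M p' g' k' δ' sB (ι c) UB VB)) *
                ∏ c ∈ t.2.1, ((1 - bFactorAt F N ϑ.ν ϑ.τ9.M p g k δ' s c U V') * (1 - bFactorAt F N ϑ.ν ϑ.τ9.M p' g' k' δ' sB (ι c) UB VB))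
            else 0) *
            ϑ.ζ p g k s t.1 t.2.1 t.2.2 U V')
        s' U V' ≤ wTop2At F N ϑ θ δ' p g k s' U V' := by
  classical
  rw [wTop2At_apply_top F N ϑ p g k hk]
  unfold resumWeights
  refine Finset.sum_le_sum fun t _ => ?_
  dsimp only [ωOfRecordAt]
  have hz := hζ0 p g k s'.init t.1 t.2.1 t.2.2 U V'
  have ha0 := aWeightAt_nonneg F N ϑ.ν ϑ.τ9.M p g k θ s'.init t.1 V'
  have hcoreB0 : 0 ≤ (if t.2.1 ⊆ qcubes F ϑ.ν ϑ.τ9.M p g k s'.init t.1 then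
        (∏ c ∈ qcubes F ϑ.ν ϑ.τ9.M p g k s'.init t.1 \ t.2.1, (bFactorAt F N ϑ.ν ϑ.τ9.M p g k δ' s'.init c U V' * bFactorAt F N ϑ.ν ϑ.τ9.M p' g' k' δ' sB (ι c) UB VB)) *
          ∏ c ∈ t.2.1, ((1 - bFactorAt F N ϑ.ν ϑ.τ9.M p g k δ' s'.init c U V') * (1 - bFactorAt F N ϑ.ν ϑ.τ9.M p' g' k' δ' sB (ι c) UB VB))
        else 0) := by
    split_ifs
    · exact mul_nonneg (prod_nonneg fun c _ => mul_nonneg (bFactorAt_nonneg F N ϑ.ν ϑ.τ9.M p g k δ' _ c U V') (bFactorAt_nonneg F N ϑ.ν ϑ.τ9.M p' g' k' δ' sB (ι c) UB VB))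
        (prod_nonneg fun c _ => mul_nonneg (sub_nonneg.2 (bFactorAt_le_one F N ϑ.ν ϑ.τ9.M p g k δ' _ c U V')) (sub_nonneg.2 (bFactorAt_le_one F N ϑ.ν ϑ.τ9.M p' g' k' δ' sB (ι c) UB VB)))
    · exact le_rfl
  have hA : (if t.1 ⊆ cubes32 F ϑ.ν ϑ.τ9.M p g k s'.init then
        (∏ c ∈ cubes32 F ϑ.ν ϑ.τ9.M p g k s'.init \ t.1, (chiFactorAt F N ϑ.ν p g k θ c V' * chiFactorAt F N ϑ.ν p' g' k' θ (ι c) VB)) *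
          ∏ c ∈ t.1, ((1 - chiFactorAt F N ϑ.ν p g k θ c V') * (1 - chiFactorAt F N ϑ.ν p' g' k' θ (ι c) VB))
        else 0) ≤ aWeightAt F N ϑ.ν ϑ.τ9.M p g k θ s'.init t.1 V' := by
    by_cases hP : t.1 ⊆ cubes32 F ϑ.ν ϑ.τ9.M p g k s'.init
    · rw [if_pos hP]
      exact core_le_aWeightAt F N ϑ.ν ϑ.τ9.M p g k θ s'.init hP V' (fun c θ' => chiFactorAt F N ϑ.ν p' g' k' θ' (ι c) VB)
        (fun c θ' => chiFactorAt_nonneg F N ϑ.ν p' g' k' θ' (ι c) VB) (fun c θ' => chiFactorAt_le_one F N ϑ.ν p' g' k' θ' (ι c) VB)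
    · rw [if_neg hP]; exact ha0
  have hB : (if t.2.1 ⊆ qcubes F ϑ.ν ϑ.τ9.M p g k s'.init t.1 then
        (∏ c ∈ qcubes F ϑ.ν ϑ.τ9.M p g k s'.init t.1 \ t.2.1, (bFactorAt F N ϑ.ν ϑ.τ9.M p g k δ' s'.init c U V' * bFactorAt F N ϑ.ν ϑ.τ9.M p' g' k' δ' sB (ι c) UB VB)) *
          ∏ c ∈ t.2.1, ((1 - bFactorAt F N ϑ.ν ϑ.τ9.M p g k δ' s'.init c U V') * (1 - bFactorAt F N ϑ.ν ϑ.τ9.M p' g' k' δ' sB (ι c) UB VB))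
        else 0) ≤ bWeightAt F N ϑ.ν ϑ.τ9.M p g k δ' s'.init t.1 t.2.1 U V' := by
    by_cases hQ : t.2.1 ⊆ qcubes F ϑ.ν ϑ.τ9.M p g k s'.init t.1
    · rw [if_pos hQ]
      exact core_le_bWeightAt F N ϑ.ν ϑ.τ9.M p g k δ' s'.init hQ U V' (fun c θ' => bFactorAt F N ϑ.ν ϑ.τ9.M p' g' k' θ' sB (ι c) UB VB)
        (fun c θ' => bFactorAt_nonneg F N ϑ.ν ϑ.τ9.M p' g' k' θ' sB (ι c) UB VB) (fun c θ' => bFactorAt_le_one F N ϑ.ν ϑ.τ9.M p' g' k' θ' sB (ι c) UB VB)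
    · rw [if_neg hQ]; exact bWeightAt_nonneg F N ϑ.ν ϑ.τ9.M p g k δ' s'.init t.1 t.2.1 U V'
  exact mul_le_mul_of_nonneg_right (mul_le_mul hA hB hcoreB0 ha0) hz

/-- ★★ **THE RESUMMED PAIR JUNCTION, DEFICIT FORM**: design (i)'s resummed pair deficit of the last step weight is at most dag-n21-w7's doubly-gapped deficit,
`wTop2At θ δ′ (s′)(U,V′) − (two-run pair core) ≤ wTop2At θ δ′ (s′)(U,V′) − wGap2At θlo θhi δlo δhi (s′)(U,V′)` — pointwise, hypotheses of `wGap2At_le_twoRunCore2_of_close`. [bookkeeping] -/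
theorem wTop2At_sub_twoRunCore2_le_wTop2At_sub_wGap2At_of_close (hζ0 : ∀ p g k s Pl Ql RS U V', 0 ≤ ϑ.ζ p g k s Pl Ql RS U V')
    {p p' : B12.RunParams} {g g' : ℕ → ℝ} {k k' : ℕ} (ι : Iχ F ϑ.ν p g k → Iχ F ϑ.ν p' g' k')
    (s' : SeqOfRecord F ϑ.ν ϑ.τ9.M g p.K (k + 1)) (sB : SeqOfRecord F ϑ.ν ϑ.τ9.M g' p'.K k')
    (U : GaugeField (F.P p.K) k (SU N)) (V' : GaugeField (F.P p.K) (k + 1) (SU N)) (UB : GaugeField (F.P p'.K) k' (SU N)) (VB : GaugeField (F.P p'.K) (k' + 1) (SU N))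
    {Δ Δ' : ℝ} (hΔ : 0 ≤ Δ) (hΔ' : 0 ≤ Δ')
    (hAB : ∀ c : Iχ F ϑ.ν p g k, ∀ q' ∈ plaqInside (cubeEnl (F.P p'.K) (sideχ F ϑ.ν p' g' k') (ι c) 1), ∃ q ∈ plaqInside (cubeEnl (F.P p.K) (sideχ F ϑ.ν p g k) c 1),
      dist1 (plaqHol (ukBox (bgOfRecord (avOfRecord F N p'.K) {U | PlaqSmall (ϑ.ν.εreg * (F.P p'.K).eta (k' + 1) ^ 2) U}) ϑ.ν.M₁
          (cubeEnl (F.P p'.K) (sideχ F ϑ.ν p' g' k') (ι c) 4) (k' + 1) VB) q') / (F.P p'.K).eta (k' + 1) ^ 2 ≤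
        dist1 (plaqHol (ukBox (bgOfRecord (avOfRecord F N p.K) {U | PlaqSmall (ϑ.ν.εreg * (F.P p.K).eta (k + 1) ^ 2) U}) ϑ.ν.M₁
          (cubeEnl (F.P p.K) (sideχ F ϑ.ν p g k) c 4) (k + 1) V') q) / (F.P p.K).eta (k + 1) ^ 2 + Δ)
    (hBA : ∀ c : Iχ F ϑ.ν p g k, ∀ q ∈ plaqInside (cubeEnl (F.P p.K) (sideχ F ϑ.ν p g k) c 1), ∃ q' ∈ plaqInside (cubeEnl (F.P p'.K) (sideχ F ϑ.ν p' g' k') (ι c) 1),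
      dist1 (plaqHol (ukBox (bgOfRecord (avOfRecord F N p.K) {U | PlaqSmall (ϑ.ν.εreg * (F.P p.K).eta (k + 1) ^ 2) U}) ϑ.ν.M₁
          (cubeEnl (F.P p.K) (sideχ F ϑ.ν p g k) c 4) (k + 1) V') q) / (F.P p.K).eta (k + 1) ^ 2 ≤
        dist1 (plaqHol (ukBox (bgOfRecord (avOfRecord F N p'.K) {U | PlaqSmall (ϑ.ν.εreg * (F.P p'.K).eta (k' + 1) ^ 2) U}) ϑ.ν.M₁
          (cubeEnl (F.P p'.K) (sideχ F ϑ.ν p' g' k') (ι c) 4) (k' + 1) VB) q') / (F.P p'.K).eta (k' + 1) ^ 2 + Δ)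
    (hAB' : ∀ c : Iχ F ϑ.ν p g k, ∀ b' ∈ (sect3DataOfRecord F N ϑ.ν ϑ.τ9.M p' g' k' sB).bondsStar (ι c), ∃ b ∈ (sect3DataOfRecord F N ϑ.ν ϑ.τ9.M p g k s'.init).bondsStar c,
      dist1 (UB b' * (Vbox (sect3DataOfRecord F N ϑ.ν ϑ.τ9.M p' g' k' sB) (avOfRecord F N p'.K) (ι c) VB b')⁻¹) ≤
        dist1 (U b * (Vbox (sect3DataOfRecord F N ϑ.ν ϑ.τ9.M p g k s'.init) (avOfRecord F N p.K) c V' b)⁻¹) + Δ')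
    (hBA' : ∀ c : Iχ F ϑ.ν p g k, ∀ b ∈ (sect3DataOfRecord F N ϑ.ν ϑ.τ9.M p g k s'.init).bondsStar c, ∃ b' ∈ (sect3DataOfRecord F N ϑ.ν ϑ.τ9.M p' g' k' sB).bondsStar (ι c),
      dist1 (U b * (Vbox (sect3DataOfRecord F N ϑ.ν ϑ.τ9.M p g k s'.init) (avOfRecord F N p.K) c V' b)⁻¹) ≤
        dist1 (UB b' * (Vbox (sect3DataOfRecord F N ϑ.ν ϑ.τ9.M p' g' k' sB) (avOfRecord F N p'.K) (ι c) VB b')⁻¹) + Δ')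
    {θlo θ θhi δlo δ' δhi : ℝ} (hlo : θlo + Δ ≤ θ) (hhi : θ + Δ ≤ θhi) (hlo' : δlo + Δ' ≤ δ') (hhi' : δ' + Δ' ≤ δhi) :
    wTop2At F N ϑ θ δ' p g k s' U V' -
      resumWeights (σOfRecord F ϑ.ν ϑ.τ9.M p g k)
        (fun s t U V' =>
          (if t.1 ⊆ cubes32 F ϑ.ν ϑ.τ9.M p g k s then
              (∏ c ∈ cubes32 F ϑ.ν ϑ.τ9.M p g k s \ t.1, (chiFactorAt F N ϑ.ν p g k θ c V' * chiFactorAt F N ϑ.ν p' g' k' θ (ι c) VB)) *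
                ∏ c ∈ t.1, ((1 - chiFactorAt F N ϑ.ν p g k θ c V') * (1 - chiFactorAt F N ϑ.ν p' g' k' θ (ι c) VB))
            else 0) *
          (if t.2.1 ⊆ qcubes F ϑ.ν ϑ.τ9.M p g k s t.1 then
              (∏ c ∈ qcubes F ϑ.ν ϑ.τ9.M p g k s t.1 \ t.2.1, (bFactorAt F N ϑ.ν ϑ.τ9.M p g k δ' s c U V' * bFactorAt F N ϑ.ν ϑ.τ9.M p' g' k' δ' sB (ι c) UB VB)) *
                ∏ c ∈ t.2.1, ((1 - bFactorAt F N ϑ.ν ϑ.τ9.M p g k δ' s c U V') * (1 - bFactorAt F N ϑ.ν ϑ.τ9.M p' g' k' δ' sB (ι c) UB VB))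
            else 0) *
            ϑ.ζ p g k s t.1 t.2.1 t.2.2 U V')
        s' U V' ≤
      wTop2At F N ϑ θ δ' p g k s' U V' - wGap2At F N ϑ θlo θhi δlo δhi p g k s' U V' := by
  have h := wGap2At_le_twoRunCore2_of_close F N ϑ hζ0 ι s' sB U V' UB VB hΔ hΔ' hAB hBA hAB' hBA' hlo hhi hlo' hhi'
  linarith

end Summit.QuantumFields.YangMills.Theorems.N21GappedCollarDesignIResummedPair
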